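import Literature.Algebra.EuclideanLattices.IntegerLatticeTheta
import HarnessLib

/-!
# Jacobi's theta relation of level three: `θ₂(z)θ₂(3z) − θ₃(z)θ₃(3z) + θ₄(z)θ₄(3z) = 0`
# (Conway–Sloane Ch. 4 §4.1 (27)), by two lattice substitutions in `ℤ[√−3] ⊂ ℤ[ω]`

Layer `Literature/NumberTheory/ModularForms`, namespace `Literature.NumberTheory.ModularForms` (lane
`lit-hodgefound`, Layer A4, theta-divisor row A4-17; prover seat `lit-hodgefound-p23`, row «A4-17(ba)»; sequel of
`SiegelThetaSeriesHexagonalLattice.lean` ((60): `Θ_hex = θ₃(z)θ₃(3z) + θ₂(z)θ₂(3z)`) and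
`SiegelThetaSeriesThetaDuplication.lean` ((22)–(23)), in the vocabulary of
`Literature/NumberTheory/EllipticCurves/JacobiThetaDerivativeFormula.lean` (`theta2 theta3 theta4 : ℂ → ℂ`,
`theta3_add_one : θ₃(τ+1) = θ₄(τ)`) and `Literature/Algebra/EuclideanLattices/IntegerLatticeTheta.lean`
(`Σ_k e^{πiτk²} = theta3 τ`, `Σ_k e^{πiτ(k+½)²} = theta2 τ`)).

Source followed (held text, read at the quoted chunk).

* J. H. Conway, N. J. A. Sloane, *Sphere Packings, Lattices and Groups* (3rd ed. 1999; held
  `book:conway1999-sphere-packings-lattices-groups`), Ch. 4 §4.1 [p0210 L20 – p0211 L36]: `θ₂(z) = Σ_{m∈ℤ+½} q^{m²}`,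
  `θ₃(z) = Σ_{m∈ℤ} q^{m²}` (8)–(9), `θ₄(z) = θ₃(z+1)` (10), `q = e^{πiz}`; among the "labyrinth of identities":
  **(27)** `θ₂(z)θ₂(3z) − θ₃(z)θ₃(3z) + θ₄(z)θ₄(3z) = 0`.

The book states (27) without proof; the proof here is by substitution, in the style of its proof of (60)
(§6.2, p0218): both `θ₂(z)θ₂(3z) = Σ_{(r,s)∈ℤ²} q^{(r+½)² + 3(s+½)²}` and `θ₃(z)θ₃(3z) − θ₄(z)θ₄(3z) =
Σ_{(a,b)} (1 − (−1)^{a²+3b²}) q^{a²+3b²} = 2Σ_{a+b odd} q^{a²+3b²}` equal `2 Σ_{(m,n)∈ℤ²} q^{(m+n+1)² + 3(m−n)²}`: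
the second by `(a, b) = (m+n, m−n)` (even, killed) resp. `(m+n+1, m−n)` (odd, doubled); the first by the bijection
`ℤ² ⊔ ℤ² ≃ ℤ²`, `(m, n) ↦ (r, s) = (m−2n−1, −m−1)` resp. `(n−2m−1, n)`, under which
`(r+½)² + 3(s+½)² = (m+n+1)² + 3(m−n)² = 4m² + 4n² − 4mn + 2m + 2n + 1` on both pieces (multiplication of
`(r+½) + (s+½)√−3 ∈ ℤ[ω] ∖ ℤ[√−3]` by the units `ω`, `ω̄` lands in `ℤ[√−3]`).

## What is here (everything is a theorem; no definition, no named fact, net debt `0`)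

* **`theta2_mul_theta2_three_mul : θ₂(τ)θ₂(3τ) = θ₃(τ)θ₃(3τ) − θ₄(τ)θ₄(3τ)`** and
  **`theta_relation_level_three : θ₂(τ)θ₂(3τ) − θ₃(τ)θ₃(3τ) + θ₄(τ)θ₄(3τ) = 0`** (= (27)), for `τ ∈ ℍ`;
  the two evaluations `theta2_mul_theta2_three_mul_eq_tsum`, `theta3_mul_sub_theta4_mul_eq_tsum`
  (`= 2 Σ_{(m,n)} q^{(m+n+1)²+3(m−n)²}`).

Not here: the cubic theta functions of Borwein–Borwein, (24)–(25), the level-`3` modular equation.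

## References

* [ConwaySloane1999] J. H. Conway, N. J. A. Sloane, *Sphere Packings, Lattices and Groups*, 3rd ed., Springer
  (1999), Ch. 4 §4.1 (8)–(10), (27) (pp. 102–104) (held chunks p0210–p0211); §6.2 (60) (p. 111, p0218) for the method.
-/

noncomputable section

open Complex Real Finset Filter Topology Set
open scoped UpperHalfPlane
open Literature.NumberTheory.EllipticCurves.JacobiThetaNull (theta2 theta3 theta4 theta3_add_one)
open Literature.Algebra.EuclideanLattices (summable_norm_cexp_pi_I_mul_add_sq tsum_cexp_pi_I_mul_sq_eq_theta3
  tsum_cexp_pi_I_mul_add_half_sq_eq_theta2)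

namespace Literature.NumberTheory.ModularForms

/-! ### §0 Plumbing: positivity, absolute convergence, the two substitutions, the term identities -/

section Plumbing

/-- `Im(cτ) = c·Im τ > 0` for a positive numeral `c`. [cite: ConwaySloane1999, Ch. 4 §4.1 ("Im(z) > 0") (p0210)] -/
private theorem im_natCast_mul_pos' (c : ℕ) (hc : 0 < c) (τ : ℍ) : 0 < ((c : ℂ) * (τ : ℂ)).im := by
  rw [show (c : ℂ) * τ = ((c : ℝ) : ℂ) * τ by push_cast; ring, Complex.im_ofReal_mul]
  exact mul_pos (by exact_mod_cast hc) τ.im_pos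

/-- `Σ_k |e^{πiσk²}| < ∞` for `Im σ > 0`. [cite: ConwaySloane1999, Ch. 4 §4.1 (9) (p0210)] -/
private theorem summable_norm_sq' {σ : ℂ} (hσ : 0 < σ.im) :
    Summable fun k : ℤ => ‖cexp ((π : ℂ) * I * σ * (((k : ℝ) ^ 2 : ℝ) : ℂ))‖ :=
  (summable_norm_cexp_pi_I_mul_add_sq hσ 0).congr fun k => by rw [add_zero]

/-- `θ₃(σ)θ₃(σ') = Σ_{(a,b)} e^{πiσa²} e^{πiσ'b²}` (absolutely convergent double series), `Im σ, Im σ' > 0`.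
[cite: ConwaySloane1999, Ch. 4 §4.1 (9) (p0210)] -/
private theorem theta3_mul_theta3_eq_tsum {σ σ' : ℂ} (hσ : 0 < σ.im) (hσ' : 0 < σ'.im) :
    theta3 σ * theta3 σ' = ∑' p : ℤ × ℤ, cexp ((π : ℂ) * I * σ * (((p.1 : ℝ) ^ 2 : ℝ) : ℂ)) *
      cexp ((π : ℂ) * I * σ' * (((p.2 : ℝ) ^ 2 : ℝ) : ℂ)) := by
  rw [← tsum_cexp_pi_I_mul_sq_eq_theta3, ← tsum_cexp_pi_I_mul_sq_eq_theta3,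
    tsum_mul_tsum_of_summable_norm (summable_norm_sq' hσ) (summable_norm_sq' hσ')]

/-- `θ₂(σ)θ₂(σ') = Σ_{(r,s)} e^{πiσ(r+½)²} e^{πiσ'(s+½)²}`, `Im σ, Im σ' > 0`. [cite: ConwaySloane1999, Ch. 4 §4.1 (8) (p0210)] -/
private theorem theta2_mul_theta2_eq_tsum {σ σ' : ℂ} (hσ : 0 < σ.im) (hσ' : 0 < σ'.im) :
    theta2 σ * theta2 σ' = ∑' p : ℤ × ℤ, cexp ((π : ℂ) * I * σ * ((((p.1 : ℝ) + 1 / 2) ^ 2 : ℝ) : ℂ)) *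
      cexp ((π : ℂ) * I * σ' * ((((p.2 : ℝ) + 1 / 2) ^ 2 : ℝ) : ℂ)) := by
  rw [← tsum_cexp_pi_I_mul_add_half_sq_eq_theta2, ← tsum_cexp_pi_I_mul_add_half_sq_eq_theta2,
    tsum_mul_tsum_of_summable_norm (summable_norm_cexp_pi_I_mul_add_sq hσ (1 / 2))
      (summable_norm_cexp_pi_I_mul_add_sq hσ' (1 / 2))]

/-- Summability of the double series for `θ₃(σ)θ₃(σ')`. [cite: ConwaySloane1999, Ch. 4 §4.1 (9) (p0210)] -/
private theorem summable_sq_mul {σ σ' : ℂ} (hσ : 0 < σ.im) (hσ' : 0 < σ'.im) :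
    Summable fun p : ℤ × ℤ => cexp ((π : ℂ) * I * σ * (((p.1 : ℝ) ^ 2 : ℝ) : ℂ)) *
      cexp ((π : ℂ) * I * σ' * (((p.2 : ℝ) ^ 2 : ℝ) : ℂ)) := by
  have h := summable_mul_of_summable_norm (summable_norm_sq' hσ) (summable_norm_sq' hσ')
  exact h

/-- The splitting `ℤ² = {a + b even} ⊔ {a + b odd}`: `(m, n) ↦ (m + n, m − n)` resp. `(m + n + 1, m − n)`.
[cite: ConwaySloane1999, Ch. 4 §6.2 (60) ("putting `r = …, s = …`") (p0218)] -/
private theorem exists_sumDiff_equiv' :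
    ∃ e : (ℤ × ℤ) ⊕ (ℤ × ℤ) ≃ ℤ × ℤ, (∀ p, (e (Sum.inl p)).1 = p.1 + p.2 ∧ (e (Sum.inl p)).2 = p.1 - p.2) ∧
      ∀ p, (e (Sum.inr p)).1 = p.1 + p.2 + 1 ∧ (e (Sum.inr p)).2 = p.1 - p.2 := by
  refine ⟨⟨Sum.elim (fun p => (p.1 + p.2, p.1 - p.2)) (fun p => (p.1 + p.2 + 1, p.1 - p.2)),
    fun q => if (q.1 + q.2) % 2 = 0 then Sum.inl ((q.1 + q.2) / 2, (q.1 - q.2) / 2)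
      else Sum.inr ((q.1 + q.2 - 1) / 2, (q.1 - q.2 - 1) / 2), ?_, ?_⟩, fun p => ⟨rfl, rfl⟩, fun p => ⟨rfl, rfl⟩⟩
  · rintro (⟨m, n⟩ | ⟨m, n⟩)
    · dsimp only [Sum.elim_inl]
      rw [if_pos (by omega)]
      exact congrArg Sum.inl (Prod.ext (by dsimp only; omega) (by dsimp only; omega))
    · dsimp only [Sum.elim_inr]
      rw [if_neg (by omega)]
      exact congrArg Sum.inr (Prod.ext (by dsimp only; omega) (by dsimp only; omega))
  · rintro ⟨a, b⟩
    dsimp only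
    split_ifs with h
    · rw [Sum.elim_inl]
      exact Prod.ext (by dsimp only; omega) (by dsimp only; omega)
    · rw [Sum.elim_inr]
      exact Prod.ext (by dsimp only; omega) (by dsimp only; omega)

/-- The Eisenstein-unit substitution: a bijection `ℤ² ⊔ ℤ² ≃ ℤ²`, `(m, n) ↦ (r, s) = (m − 2n − 1, −m − 1)` (the
`(r, s)` with `r ≡ s (mod 2)`) resp. `(n − 2m − 1, n)` (those with `r ≢ s`). [cite: ConwaySloane1999, Ch. 4 §4.1 (27) (p0211)] -/
private theorem exists_eisensteinUnit_equiv :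
    ∃ e : (ℤ × ℤ) ⊕ (ℤ × ℤ) ≃ ℤ × ℤ,
      (∀ p, (e (Sum.inl p)).1 = p.1 - 2 * p.2 - 1 ∧ (e (Sum.inl p)).2 = -p.1 - 1) ∧
      ∀ p, (e (Sum.inr p)).1 = p.2 - 2 * p.1 - 1 ∧ (e (Sum.inr p)).2 = p.2 := by
  refine ⟨⟨Sum.elim (fun p => (p.1 - 2 * p.2 - 1, -p.1 - 1)) (fun p => (p.2 - 2 * p.1 - 1, p.2)),
    fun q => if (q.1 - q.2) % 2 = 0 then Sum.inl (-q.2 - 1, -((q.1 + q.2 + 2) / 2))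
      else Sum.inr ((q.2 - 1 - q.1) / 2, q.2), ?_, ?_⟩, fun p => ⟨rfl, rfl⟩, fun p => ⟨rfl, rfl⟩⟩
  · rintro (⟨m, n⟩ | ⟨m, n⟩)
    · dsimp only [Sum.elim_inl]
      rw [if_pos (by omega)]
      exact congrArg Sum.inl (Prod.ext (by dsimp only; omega) (by dsimp only; omega))
    · dsimp only [Sum.elim_inr]
      rw [if_neg (by omega)]
      exact congrArg Sum.inr (Prod.ext (by dsimp only; omega) rfl)
  · rintro ⟨r, s⟩
    dsimp only
    split_ifs with h
    · rw [Sum.elim_inl]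
      exact Prod.ext (by dsimp only; omega) (by dsimp only; omega)
    · rw [Sum.elim_inr]
      exact Prod.ext (by dsimp only; omega) rfl

/-- `(r+½)² + 3(s+½)² = (m+n+1)² + 3(m−n)²` for `(r, s) = (m−2n−1, −m−1)`, in the exponent.
[cite: ConwaySloane1999, Ch. 4 §4.1 (27) (p0211)] -/
private theorem halfTerm_inl (τ : ℂ) (m n : ℤ) :
    cexp ((π : ℂ) * I * τ * (((((m - 2 * n - 1 : ℤ) : ℝ) + 1 / 2) ^ 2 : ℝ) : ℂ)) *
        cexp ((π : ℂ) * I * (3 * τ) * (((((-m - 1 : ℤ) : ℝ) + 1 / 2) ^ 2 : ℝ) : ℂ)) =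
      cexp ((π : ℂ) * I * τ * ((((m + n + 1 : ℤ) : ℝ) ^ 2 : ℝ) : ℂ)) *
        cexp ((π : ℂ) * I * (3 * τ) * ((((m - n : ℤ) : ℝ) ^ 2 : ℝ) : ℂ)) := by
  rw [← Complex.exp_add, ← Complex.exp_add]
  congr 1
  push_cast
  ring

/-- `(r+½)² + 3(s+½)² = (m+n+1)² + 3(m−n)²` for `(r, s) = (n−2m−1, n)`, in the exponent.
[cite: ConwaySloane1999, Ch. 4 §4.1 (27) (p0211)] -/
private theorem halfTerm_inr (τ : ℂ) (m n : ℤ) :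
    cexp ((π : ℂ) * I * τ * (((((n - 2 * m - 1 : ℤ) : ℝ) + 1 / 2) ^ 2 : ℝ) : ℂ)) *
        cexp ((π : ℂ) * I * (3 * τ) * (((((n : ℤ) : ℝ) + 1 / 2) ^ 2 : ℝ) : ℂ)) =
      cexp ((π : ℂ) * I * τ * ((((m + n + 1 : ℤ) : ℝ) ^ 2 : ℝ) : ℂ)) *
        cexp ((π : ℂ) * I * (3 * τ) * ((((m - n : ℤ) : ℝ) ^ 2 : ℝ) : ℂ)) := by
  rw [← Complex.exp_add, ← Complex.exp_add]
  congr 1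
  push_cast
  ring

/-- At `(a, b) = (m+n, m−n)`, `a² + b²` is even: the terms of `θ₃(τ+1)θ₃(3τ+1)` and `θ₃(τ)θ₃(3τ)` agree.
[cite: ConwaySloane1999, Ch. 4 §4.1 (10), (27) (p0210–p0211)] -/
private theorem sqTerm_inl (τ : ℂ) (m n : ℤ) :
    cexp ((π : ℂ) * I * (τ + 1) * ((((m + n : ℤ) : ℝ) ^ 2 : ℝ) : ℂ)) *
        cexp ((π : ℂ) * I * (3 * τ + 1) * ((((m - n : ℤ) : ℝ) ^ 2 : ℝ) : ℂ)) =
      cexp ((π : ℂ) * I * τ * ((((m + n : ℤ) : ℝ) ^ 2 : ℝ) : ℂ)) *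
        cexp ((π : ℂ) * I * (3 * τ) * ((((m - n : ℤ) : ℝ) ^ 2 : ℝ) : ℂ)) := by
  rw [← Complex.exp_add, ← Complex.exp_add, show (π : ℂ) * I * (τ + 1) * ((((m + n : ℤ) : ℝ) ^ 2 : ℝ) : ℂ) +
        (π : ℂ) * I * (3 * τ + 1) * ((((m - n : ℤ) : ℝ) ^ 2 : ℝ) : ℂ) =
      (π : ℂ) * I * τ * ((((m + n : ℤ) : ℝ) ^ 2 : ℝ) : ℂ) + (π : ℂ) * I * (3 * τ) * ((((m - n : ℤ) : ℝ) ^ 2 : ℝ) : ℂ) +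
        ((m ^ 2 + n ^ 2 : ℤ) : ℂ) * (2 * π * I) by push_cast; ring,
    Complex.exp_add _ (((m ^ 2 + n ^ 2 : ℤ) : ℂ) * (2 * π * I)), Complex.exp_int_mul_two_pi_mul_I, mul_one]

/-- At `(a, b) = (m+n+1, m−n)`, `a² + b²` is odd: the term of `θ₃(τ+1)θ₃(3τ+1)` is minus that of `θ₃(τ)θ₃(3τ)`.
[cite: ConwaySloane1999, Ch. 4 §4.1 (10), (27) (p0210–p0211)] -/
private theorem sqTerm_inr (τ : ℂ) (m n : ℤ) :
    cexp ((π : ℂ) * I * (τ + 1) * ((((m + n + 1 : ℤ) : ℝ) ^ 2 : ℝ) : ℂ)) *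
        cexp ((π : ℂ) * I * (3 * τ + 1) * ((((m - n : ℤ) : ℝ) ^ 2 : ℝ) : ℂ)) =
      -(cexp ((π : ℂ) * I * τ * ((((m + n + 1 : ℤ) : ℝ) ^ 2 : ℝ) : ℂ)) *
        cexp ((π : ℂ) * I * (3 * τ) * ((((m - n : ℤ) : ℝ) ^ 2 : ℝ) : ℂ))) := by
  rw [← Complex.exp_add, ← Complex.exp_add, show (π : ℂ) * I * (τ + 1) * ((((m + n + 1 : ℤ) : ℝ) ^ 2 : ℝ) : ℂ) +
        (π : ℂ) * I * (3 * τ + 1) * ((((m - n : ℤ) : ℝ) ^ 2 : ℝ) : ℂ) =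
      (π : ℂ) * I * τ * ((((m + n + 1 : ℤ) : ℝ) ^ 2 : ℝ) : ℂ) +
        (π : ℂ) * I * (3 * τ) * ((((m - n : ℤ) : ℝ) ^ 2 : ℝ) : ℂ) +
        (((m ^ 2 + n ^ 2 + m + n : ℤ) : ℂ) * (2 * π * I) + π * I) by push_cast; ring,
    Complex.exp_add _ (((m ^ 2 + n ^ 2 + m + n : ℤ) : ℂ) * (2 * π * I) + π * I),
    Complex.exp_add (((m ^ 2 + n ^ 2 + m + n : ℤ) : ℂ) * (2 * π * I)) (π * I),
    Complex.exp_int_mul_two_pi_mul_I, Complex.exp_pi_mul_I]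
  ring

end Plumbing

/-! ### §1 Both sides as `2 Σ_{(m,n)} q^{(m+n+1)² + 3(m−n)²}`; the relation (27) -/

section LevelThree

/-- **`θ₂(τ)θ₂(3τ) = 2 Σ_{(m,n)∈ℤ²} e^{πiτ(m+n+1)²} e^{3πiτ(m−n)²}`** (the Eisenstein-unit substitution).
[cite: ConwaySloane1999, Ch. 4 §4.1 (27) (p0211)] -/
theorem theta2_mul_theta2_three_mul_eq_tsum (τ : ℍ) :
    theta2 (τ : ℂ) * theta2 (3 * (τ : ℂ)) = 2 * ∑' p : ℤ × ℤ,
      cexp ((π : ℂ) * I * (τ : ℂ) * ((((p.1 + p.2 + 1 : ℤ) : ℝ) ^ 2 : ℝ) : ℂ)) *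
        cexp ((π : ℂ) * I * (3 * (τ : ℂ)) * ((((p.1 - p.2 : ℤ) : ℝ) ^ 2 : ℝ) : ℂ)) := by
  have h3 := im_natCast_mul_pos' 3 (by norm_num) τ
  push_cast at h3
  obtain ⟨e, he₁, he₂⟩ := exists_eisensteinUnit_equiv
  -- the target double series is summable: it is a subseries of that of `θ₃(τ)θ₃(3τ)` (via `inr` of the other splitting)
  obtain ⟨e', -, he'₂⟩ := exists_sumDiff_equiv'
  have hS : Summable fun p : ℤ × ℤ => cexp ((π : ℂ) * I * (τ : ℂ) * ((((p.1 + p.2 + 1 : ℤ) : ℝ) ^ 2 : ℝ) : ℂ)) *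
      cexp ((π : ℂ) * I * (3 * (τ : ℂ)) * ((((p.1 - p.2 : ℤ) : ℝ) ^ 2 : ℝ) : ℂ)) := by
    have h := ((summable_sq_mul τ.im_pos h3).comp_injective e'.injective).comp_injective Sum.inr_injective
    refine h.congr fun p => ?_
    change cexp ((π : ℂ) * I * (τ : ℂ) * ((((e' (Sum.inr p)).1 : ℝ) ^ 2 : ℝ) : ℂ)) *
        cexp ((π : ℂ) * I * (3 * (τ : ℂ)) * ((((e' (Sum.inr p)).2 : ℝ) ^ 2 : ℝ) : ℂ)) = _
    rw [(he'₂ p).1, (he'₂ p).2]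
  rw [theta2_mul_theta2_eq_tsum τ.im_pos h3, ← e.tsum_eq, Summable.tsum_sum, two_mul]
  · congr 1
    · exact tsum_congr fun p => by rw [(he₁ p).1, (he₁ p).2]; exact halfTerm_inl (τ : ℂ) p.1 p.2
    · exact tsum_congr fun p => by rw [(he₂ p).1, (he₂ p).2]; exact halfTerm_inr (τ : ℂ) p.1 p.2
  · refine hS.congr fun p => ?_
    change _ = cexp ((π : ℂ) * I * (τ : ℂ) * (((((e (Sum.inl p)).1 : ℝ) + 1 / 2) ^ 2 : ℝ) : ℂ)) *
      cexp ((π : ℂ) * I * (3 * (τ : ℂ)) * (((((e (Sum.inl p)).2 : ℝ) + 1 / 2) ^ 2 : ℝ) : ℂ))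
    rw [(he₁ p).1, (he₁ p).2, halfTerm_inl]
  · refine hS.congr fun p => ?_
    change _ = cexp ((π : ℂ) * I * (τ : ℂ) * (((((e (Sum.inr p)).1 : ℝ) + 1 / 2) ^ 2 : ℝ) : ℂ)) *
      cexp ((π : ℂ) * I * (3 * (τ : ℂ)) * (((((e (Sum.inr p)).2 : ℝ) + 1 / 2) ^ 2 : ℝ) : ℂ))
    rw [(he₂ p).1, (he₂ p).2, halfTerm_inr]

/-- **`θ₃(τ)θ₃(3τ) − θ₄(τ)θ₄(3τ) = 2 Σ_{(m,n)∈ℤ²} e^{πiτ(m+n+1)²} e^{3πiτ(m−n)²}`** (`= 2Σ_{a+b odd} q^{a²+3b²}`: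
the terms with `a + b` even cancel, those with `a + b` odd double). [cite: ConwaySloane1999, Ch. 4 §4.1 (10), (27) (p0210–p0211)] -/
theorem theta3_mul_sub_theta4_mul_eq_tsum (τ : ℍ) :
    theta3 (τ : ℂ) * theta3 (3 * (τ : ℂ)) - theta4 (τ : ℂ) * theta4 (3 * (τ : ℂ)) = 2 * ∑' p : ℤ × ℤ,
      cexp ((π : ℂ) * I * (τ : ℂ) * ((((p.1 + p.2 + 1 : ℤ) : ℝ) ^ 2 : ℝ) : ℂ)) *
        cexp ((π : ℂ) * I * (3 * (τ : ℂ)) * ((((p.1 - p.2 : ℤ) : ℝ) ^ 2 : ℝ) : ℂ)) := by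
  have h3 := im_natCast_mul_pos' 3 (by norm_num) τ
  push_cast at h3
  have h1 : 0 < ((τ : ℂ) + 1).im := by simpa using τ.im_pos
  have h31 : 0 < (3 * (τ : ℂ) + 1).im := by simpa using h3
  obtain ⟨e, he₁, he₂⟩ := exists_sumDiff_equiv'
  rw [← theta3_add_one, ← theta3_add_one, theta3_mul_theta3_eq_tsum τ.im_pos h3,
    theta3_mul_theta3_eq_tsum h1 h31, ← (summable_sq_mul τ.im_pos h3).tsum_sub (summable_sq_mul h1 h31),
    ← e.tsum_eq, Summable.tsum_sum, ← tsum_mul_left]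
  · rw [← zero_add (∑' p : ℤ × ℤ, 2 * _)]
    congr 1
    · rw [← tsum_zero (α := ℂ) (β := ℤ × ℤ)]
      refine tsum_congr fun p => ?_
      rw [(he₁ p).1, (he₁ p).2, sqTerm_inl, sub_self]
    · refine tsum_congr fun p => ?_
      rw [(he₂ p).1, (he₂ p).2, sqTerm_inr, sub_neg_eq_add]
      exact (two_mul _).symm
  · refine (summable_zero (β := ℤ × ℤ) (α := ℂ)).congr fun p => ?_
    change (0 : ℂ) = cexp ((π : ℂ) * I * (τ : ℂ) * ((((e (Sum.inl p)).1 : ℝ) ^ 2 : ℝ) : ℂ)) *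
        cexp ((π : ℂ) * I * (3 * (τ : ℂ)) * ((((e (Sum.inl p)).2 : ℝ) ^ 2 : ℝ) : ℂ)) -
      cexp ((π : ℂ) * I * ((τ : ℂ) + 1) * ((((e (Sum.inl p)).1 : ℝ) ^ 2 : ℝ) : ℂ)) *
        cexp ((π : ℂ) * I * (3 * (τ : ℂ) + 1) * ((((e (Sum.inl p)).2 : ℝ) ^ 2 : ℝ) : ℂ))
    rw [(he₁ p).1, (he₁ p).2, sqTerm_inl, sub_self]
  · have hS := ((summable_sq_mul τ.im_pos h3).comp_injective e.injective).comp_injective Sum.inr_injective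
    refine (hS.mul_left 2).congr fun p => ?_
    change 2 * (cexp ((π : ℂ) * I * (τ : ℂ) * ((((e (Sum.inr p)).1 : ℝ) ^ 2 : ℝ) : ℂ)) *
        cexp ((π : ℂ) * I * (3 * (τ : ℂ)) * ((((e (Sum.inr p)).2 : ℝ) ^ 2 : ℝ) : ℂ))) =
      cexp ((π : ℂ) * I * (τ : ℂ) * ((((e (Sum.inr p)).1 : ℝ) ^ 2 : ℝ) : ℂ)) *
        cexp ((π : ℂ) * I * (3 * (τ : ℂ)) * ((((e (Sum.inr p)).2 : ℝ) ^ 2 : ℝ) : ℂ)) -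
      cexp ((π : ℂ) * I * ((τ : ℂ) + 1) * ((((e (Sum.inr p)).1 : ℝ) ^ 2 : ℝ) : ℂ)) *
        cexp ((π : ℂ) * I * (3 * (τ : ℂ) + 1) * ((((e (Sum.inr p)).2 : ℝ) ^ 2 : ℝ) : ℂ))
    rw [(he₂ p).1, (he₂ p).2, sqTerm_inr, sub_neg_eq_add, two_mul]

/-- **`θ₂(τ)θ₂(3τ) = θ₃(τ)θ₃(3τ) − θ₄(τ)θ₄(3τ)`** for `τ ∈ ℍ`. [cite: ConwaySloane1999, Ch. 4 §4.1 (27) (p0211)] -/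
theorem theta2_mul_theta2_three_mul (τ : ℍ) :
    theta2 (τ : ℂ) * theta2 (3 * (τ : ℂ)) = theta3 (τ : ℂ) * theta3 (3 * (τ : ℂ)) - theta4 (τ : ℂ) * theta4 (3 * (τ : ℂ)) := by
  rw [theta2_mul_theta2_three_mul_eq_tsum, theta3_mul_sub_theta4_mul_eq_tsum]

/-- **Conway–Sloane (27): `θ₂(z)θ₂(3z) − θ₃(z)θ₃(3z) + θ₄(z)θ₄(3z) = 0`** for `Im z > 0`.
[cite: ConwaySloane1999, Ch. 4 §4.1 (27) (p0211)] -/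
theorem theta_relation_level_three (τ : ℍ) :
    theta2 (τ : ℂ) * theta2 (3 * (τ : ℂ)) - theta3 (τ : ℂ) * theta3 (3 * (τ : ℂ)) +
      theta4 (τ : ℂ) * theta4 (3 * (τ : ℂ)) = 0 := by
  rw [theta2_mul_theta2_three_mul]
  ring

end LevelThree

end Literature.NumberTheory.ModularForms

end
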